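/-
COR-CM (cell pub-hodgecm2, stage 2 of the Hodge ladder) — count-neutral KERNEL COMBINATORICS «the order-16 dispatch», part I: the STRUCTURE of the
exponent-4 groups of order 16 — pure group theory for the classification-free assembly «every group of order 16, every central involution»
(seat prover-pub-hodgecm2-b23-g55-0, binder prover b23, gen 55; claim HOME/INBOX.md l.25631).  Theorems only; no `decide`, no certificate, no named fact,
no `sorry`.  `Interfaces.lean` (C1), every E term, B01, `Transposition/*`, `PortJoin/*`, `D2Bridge/*` untouched.
HONEST FRAMING: `HC_CM` is NOT proved, here or anywhere in the tree; nothing here is a period, a count of record or a headline.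
T5: n/a-class (hypothesis binders `|G| = 16`, no element of order `8`, a non-commuting pair — inhabited by `D₄ × ℤ/2`, `Q₈ × ℤ/2`, the Pauli group,
`ℤ/4 ⋊ ℤ/4`, `G(16,3)`); checker: self.
-/
import Mathlib.GroupTheory.Commutator.Basic
import Summits.HodgeConjecture.CorCM.Census.QuaternionDoublingOrderSixteen

/-!
# The order-16 dispatch, I: structure of the exponent-4 groups of order 16

Pure group theory of a finite group `G` of order `16` WITHOUT an element of order `8` (so `g⁴ = 1` for all `g`, part X of the quaternion-doubling
lane), classification-free:
* §1 small tools: the two-element and four-element listings of a subgroup, central commutator calculus (`⁅x, y·w⁆ = ⁅x,y⁆⁅x,w⁆` when commutators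
  are central);
* §2 **every square is central** (`mul_self_mem_center`): in `G ⧸ Z(G)` the image of `u` has order `≤ 2` unless `G ⧸ Z(G)` is cyclic of order `4`
  (then `G` is abelian) or `⟨ū⟩ ⊴ G ⧸ Z(G)` has index `2` (then `g u g⁻¹ ∈ {u, u³}·Z(G)` and `|Z(G)| = 2` give `g u² g⁻¹ = u²`); hence every
  commutator is central (`commutatorElement_mem_center`);
* §3 **the centre has order `4`** when `G` is non-abelian (`card_center_eq_four`): order `2` is impossible — `G ⧸ Z(G)` would be elementary abelian
  of order `8` with a nondegenerate commutator pairing, but then for non-commuting `a, b` the subgroup `C(a) ∩ C(b)` of order `4` is abelian and contains,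
  next to `Z(G)`, an element `d` and a partner not commuting with `d`;
Part II (`Census/OrderSixteenCommutator.lean`) adds the normal form `G = Z ∪ aZ ∪ bZ ∪ abZ` and `[G,G] = {1, ⁅a,b⁆}`.
All [folklore].

## References
* [Pohlmann1968] H. Pohlmann, Algebraic cycles on abelian varieties of complex multiplication type, Ann. of Math. 88 (1968), Thm 1.
-/

namespace Summit.HodgeConjecture.CorCM.Census.OrderSixteen

open Subgroup
open scoped commutatorElement

variable {G : Type*} [Group G]

/-! ## §1 Small tools -/

/-- In a subgroup of order `2`, every element is `1` or the given non-trivial element. [folklore] -/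
theorem eq_one_or_eq_of_card_two [Finite G] (H : Subgroup G) (h2 : Nat.card H = 2) {x : G} (hx : x ∈ H) (hx1 : x ≠ 1)
    {t : G} (ht : t ∈ H) : t = 1 ∨ t = x := by
  classical
  by_contra h
  push Not at h
  haveI : Fintype H := Fintype.ofFinite H
  let S : Finset H := {⟨1, H.one_mem⟩, ⟨x, hx⟩, ⟨t, ht⟩}
  have hS : S.card = 3 := by
    refine Finset.card_eq_three.mpr ⟨⟨1, H.one_mem⟩, ⟨x, hx⟩, ⟨t, ht⟩, ?_, ?_, ?_, rfl⟩
    · exact fun e => hx1 (Subtype.ext_iff.mp e).symm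
    · exact fun e => h.1 (Subtype.ext_iff.mp e).symm
    · exact fun e => h.2 (Subtype.ext_iff.mp e).symm
  have hle : S.card ≤ Fintype.card H := Finset.card_le_univ S
  rw [hS, ← Nat.card_eq_fintype_card, h2] at hle
  omega

/-- An element of a subgroup of order `2` squares to `1`. [folklore] -/
theorem mul_self_eq_one_of_card_two [Finite G] (H : Subgroup G) (h2 : Nat.card H = 2) {t : G} (ht : t ∈ H) : t * t = 1 := by
  have h : (⟨t, ht⟩ : H) ^ Nat.card H = 1 := pow_card_eq_one'
  rw [h2] at h
  have h' := congrArg Subtype.val h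
  simpa [pow_two] using h'

/-- In a subgroup of order `4` containing the four distinct elements `1, x, y, x y`, every element is one of them. [folklore] -/
theorem mem_four_of_card_four [Finite G] (H : Subgroup G) (h4 : Nat.card H = 4) {x y : G} (hx : x ∈ H) (hy : y ∈ H) (hx1 : x ≠ 1)
    (hy1 : y ≠ 1) (hxy : x ≠ y) (hxy1 : x * y ≠ 1) (hxyx : x * y ≠ x) (hxyy : x * y ≠ y) {t : G} (ht : t ∈ H) :
    t = 1 ∨ t = x ∨ t = y ∨ t = x * y := by
  classical
  by_contra h
  push Not at h
  haveI : Fintype H := Fintype.ofFinite H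
  have hxyH : x * y ∈ H := H.mul_mem hx hy
  let S : Finset H := {⟨1, H.one_mem⟩, ⟨x, hx⟩, ⟨y, hy⟩, ⟨x * y, hxyH⟩, ⟨t, ht⟩}
  have hS : S.card = 5 := by
    simp only [S, Finset.card_insert_of_notMem, Finset.mem_insert, Finset.mem_singleton, Subtype.mk.injEq, Finset.card_singleton,
      hx1.symm, hy1.symm, hxy1.symm, h.1.symm, hxy, hxyx.symm, h.2.1.symm, hxyy.symm, h.2.2.1.symm, h.2.2.2.symm, or_self,
      not_false_eq_true]
  have hle : S.card ≤ Fintype.card H := Finset.card_le_univ S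
  rw [hS, ← Nat.card_eq_fintype_card, h4] at hle
  omega

/-- `⁅x, y·w⁆ = ⁅x, y⁆ · ⁅x, w⁆` when `⁅x, w⁆` is central. [folklore] -/
theorem commutatorElement_mul_right {x y w : G} (h : ∀ g : G, g * ⁅x, w⁆ = ⁅x, w⁆ * g) : ⁅x, y * w⁆ = ⁅x, y⁆ * ⁅x, w⁆ := by
  have key : ⁅x, y * w⁆ = ⁅x, y⁆ * (y * ⁅x, w⁆ * y⁻¹) := by simp only [commutatorElement_def]; group
  rw [key, h y, mul_inv_cancel_right]

/-- `⁅x·y, w⁆ = ⁅x, w⁆ · ⁅y, w⁆` when `⁅y, w⁆` is central. [folklore] -/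
theorem commutatorElement_mul_left {x y w : G} (h : ∀ g : G, g * ⁅y, w⁆ = ⁅y, w⁆ * g) : ⁅x * y, w⁆ = ⁅x, w⁆ * ⁅y, w⁆ := by
  have key : ⁅x * y, w⁆ = (x * ⁅y, w⁆ * x⁻¹) * ⁅x, w⁆ := by simp only [commutatorElement_def]; group
  rw [key, h x, mul_inv_cancel_right]
  exact (h ⁅x, w⁆).symm

/-- `⁅x, z⁆ = 1` for `z` central. [folklore] -/
theorem commutatorElement_eq_one_of_central_right {x z : G} (hz : ∀ g : G, g * z = z * g) : ⁅x, z⁆ = 1 :=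
  commutatorElement_eq_one_iff_mul_comm.mpr (hz x)

/-- `⁅z, x⁆ = 1` for `z` central. [folklore] -/
theorem commutatorElement_eq_one_of_central_left {x z : G} (hz : ∀ g : G, g * z = z * g) : ⁅z, x⁆ = 1 :=
  commutatorElement_eq_one_iff_mul_comm.mpr (hz x).symm

/-- A commutative group has trivial commutator subgroup (pointwise form). [folklore] -/
theorem commutator_eq_bot_of_forall_comm (h : ∀ a b : G, a * b = b * a) : commutator G = ⊥ := by
  rw [commutator_def, eq_bot_iff]
  exact Subgroup.commutator_le.mpr fun g₁ _ g₂ _ => by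
    rw [Subgroup.mem_bot]; exact commutatorElement_eq_one_iff_mul_comm.mpr (h g₁ g₂)

/-- Membership in the centraliser of a singleton. [folklore] -/
theorem mem_centralizer_singleton {a x : G} : x ∈ centralizer ({a} : Set G) ↔ a * x = x * a := by
  rw [mem_centralizer_iff]
  exact ⟨fun h => h a rfl, fun h y hy => by rw [Set.mem_singleton_iff.mp hy]; exact h⟩

/-! ## §2 Every square is central -/

section Structure

variable [Finite G] (hG : Nat.card G = 16) (h8 : ∀ u : G, orderOf u ≠ 8)
include hG h8

omit h8 in
/-- The centre has order `2`, `4`, `8` or `16`. [folklore] -/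
theorem card_center_mem : Nat.card (center G) = 2 ∨ Nat.card (center G) = 4 ∨ Nat.card (center G) = 8 ∨ Nat.card (center G) = 16 := by
  haveI : Fact (Nat.Prime 2) := ⟨Nat.prime_two⟩
  obtain ⟨k, hk, hZ⟩ := IsPGroup.card_center_eq_prime_pow (p := 2) (n := 4) (by rw [hG]; norm_num) (by norm_num)
  have hle : Nat.card (center G) ≤ 16 := hG ▸ Subgroup.card_le_card_group _
  have hk4 : k ≤ 4 := by
    by_contra h
    have : 2 ^ 5 ≤ 2 ^ k := Nat.pow_le_pow_right (by norm_num) (by omega)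
    rw [← hZ] at this; omega
  interval_cases k <;> simp_all

omit [Finite G] h8 in
/-- **If the centre has order `≥ 8` then `G` is abelian** (cyclic central quotient). [folklore] -/
theorem comm_of_card_center_ge (h : Nat.card (center G) = 8 ∨ Nat.card (center G) = 16) (a b : G) : a * b = b * a := by
  haveI : Fact (Nat.Prime 2) := ⟨Nat.prime_two⟩
  have hq : Nat.card G = Nat.card (G ⧸ center G) * Nat.card (center G) := Subgroup.card_eq_card_quotient_mul_card_subgroup _
  rw [hG] at hq
  have hker : (QuotientGroup.mk' (center G)).ker ≤ center G := by rw [QuotientGroup.ker_mk']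
  rcases h with h | h
  · rw [h] at hq
    haveI : IsCyclic (G ⧸ center G) := isCyclic_of_prime_card (p := 2) (by omega)
    exact ((QuotientGroup.mk' (center G)).isMulCommutative_of_isCyclic_of_ker_le_center hker).is_comm.comm a b
  · rw [h] at hq
    haveI : Subsingleton (G ⧸ center G) := (Nat.card_eq_one_iff_unique.mp (by omega)).1
    haveI : IsCyclic (G ⧸ center G) := isCyclic_of_subsingleton
    exact ((QuotientGroup.mk' (center G)).isMulCommutative_of_isCyclic_of_ker_le_center hker).is_comm.comm a b

/-- **EVERY SQUARE IS CENTRAL** in a group of order `16` without an element of order `8`. [folklore] -/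
theorem mul_self_mem_center (u : G) : u * u ∈ center G := by
  classical
  haveI : Fact (Nat.Prime 2) := ⟨Nat.prime_two⟩
  by_cases hu : u * u ∈ center G
  · exact hu
  -- the image `ū` of `u` in `G ⧸ Z` has order `4`
  have h4 : ∀ g : G, g ^ 4 = 1 := QuaternionDoubling.pow_four_eq_one_of_no_eight hG h8
  let π : G →* G ⧸ center G := QuotientGroup.mk' (center G)
  have hπu2 : π u ^ 2 ≠ 1 := by
    intro h
    rw [← map_pow, pow_two, QuotientGroup.mk'_apply, QuotientGroup.eq_one_iff] at h
    exact hu h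
  have hπu4 : π u ^ 4 = 1 := by rw [← map_pow, h4, map_one]
  have hord : orderOf (π u) = 4 := by
    have h := orderOf_eq_prime_pow (p := 2) (n := 1) (x := π u) (by simpa using hπu2) (by simpa using hπu4)
    simpa using h
  have hq : Nat.card G = Nat.card (G ⧸ center G) * Nat.card (center G) := Subgroup.card_eq_card_quotient_mul_card_subgroup _
  rw [hG] at hq
  rcases card_center_mem hG with h2 | h4Z | hbig | hbig
  · -- `|Z| = 2`, `|G ⧸ Z| = 8`: `⟨ū⟩` has index two, is normal, and conjugates of `ū` are odd powers of `ū`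
    rw [h2] at hq
    have hq8 : Nat.card (G ⧸ center G) = 8 := by omega
    rw [mem_center_iff]
    intro g
    have hidx : (zpowers (π u)).index = 2 := by
      have h := (zpowers (π u)).card_mul_index
      rw [Nat.card_zpowers, hord, hq8] at h
      omega
    haveI := normal_of_index_eq_two hidx
    have hconj : π g * π u * (π g)⁻¹ ∈ zpowers (π u) := (inferInstance : (zpowers (π u)).Normal).conj_mem _ (mem_zpowers _) _
    have hconj' : π g * π u * (π g)⁻¹ ∈ Submonoid.powers (π u) :=
      ((isOfFinOrder_of_finite (π u)).mem_powers_iff_mem_zpowers).mpr hconj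
    obtain ⟨k, hk⟩ := (Submonoid.mem_powers_iff _ _).mp hconj'
    -- `k` is odd: `(ū^k)² = ḡ ū² ḡ⁻¹ ≠ 1`
    have hkodd : k % 2 = 1 := by
      by_contra hev
      have hk2 : k = 2 * (k / 2) := by omega
      have h1 : (π u ^ k) ^ 2 = 1 := by
        rw [hk2, ← pow_mul, show 2 * (k / 2) * 2 = 4 * (k / 2) by ring, pow_mul, hπu4, one_pow]
      rw [hk, show (π g * π u * (π g)⁻¹) ^ 2 = π g * π u ^ 2 * (π g)⁻¹ by simp only [pow_succ, pow_zero, one_mul]; group] at h1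
      apply hπu2
      calc π u ^ 2 = (π g)⁻¹ * (π g * π u ^ 2 * (π g)⁻¹) * π g := by group
        _ = 1 := by rw [h1]; group
    -- lift to `G`: `g u g⁻¹ = u^k z` with `z ∈ Z`
    have hlift : (u ^ k)⁻¹ * (g * u * g⁻¹) ∈ center G := by
      rw [← QuotientGroup.eq_one_iff, ← QuotientGroup.mk'_apply, map_mul, map_inv, map_pow]
      change (π u ^ k)⁻¹ * π (g * u * g⁻¹) = 1
      rw [hk, map_mul, map_mul, map_inv, inv_mul_cancel]
    have hz : ∀ x : G, x * ((u ^ k)⁻¹ * (g * u * g⁻¹)) = ((u ^ k)⁻¹ * (g * u * g⁻¹)) * x := fun x => mem_center_iff.mp hlift x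
    have hgu : g * u * g⁻¹ = u ^ k * ((u ^ k)⁻¹ * (g * u * g⁻¹)) := by rw [mul_inv_cancel_left]
    have hzz : ((u ^ k)⁻¹ * (g * u * g⁻¹)) * ((u ^ k)⁻¹ * (g * u * g⁻¹)) = 1 := mul_self_eq_one_of_card_two (center G) h2 hlift
    have huk : u ^ k * u ^ k = u * u := by
      rw [← pow_add, show k + k = 4 * (k / 2) + 2 by omega, pow_add, pow_mul, h4, one_pow, one_mul, pow_two]
    -- square the conjugate
    have hsq : g * (u * u) * g⁻¹ = u * u := by
      calc g * (u * u) * g⁻¹ = (g * u * g⁻¹) * (g * u * g⁻¹) := by group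
        _ = u ^ k * ((u ^ k)⁻¹ * (g * u * g⁻¹)) * (u ^ k * ((u ^ k)⁻¹ * (g * u * g⁻¹))) := by rw [← hgu]
        _ = u ^ k * (((u ^ k)⁻¹ * (g * u * g⁻¹)) * u ^ k) * ((u ^ k)⁻¹ * (g * u * g⁻¹)) := by simp only [mul_assoc]
        _ = u ^ k * (u ^ k * ((u ^ k)⁻¹ * (g * u * g⁻¹))) * ((u ^ k)⁻¹ * (g * u * g⁻¹)) := by rw [hz (u ^ k)]
        _ = (u ^ k * u ^ k) * (((u ^ k)⁻¹ * (g * u * g⁻¹)) * ((u ^ k)⁻¹ * (g * u * g⁻¹))) := by simp only [mul_assoc]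
        _ = u * u := by rw [huk, hzz, mul_one]
    calc g * (u * u) = g * (u * u) * g⁻¹ * g := by group
      _ = u * u * g := by rw [hsq]
  · -- `|Z| = 4`, `|G ⧸ Z| = 4 = ord ū`: cyclic central quotient, `G` abelian
    rw [h4Z] at hq
    have hq4 : Nat.card (G ⧸ center G) = 4 := by omega
    haveI : IsCyclic (G ⧸ center G) := isCyclic_of_orderOf_eq_card (π u) (by rw [hord, hq4])
    have hker : π.ker ≤ center G := by rw [QuotientGroup.ker_mk']
    have hcomm := (π.isMulCommutative_of_isCyclic_of_ker_le_center hker).is_comm.comm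
    exact mem_center_iff.mpr fun g => hcomm g (u * u)
  · exact mem_center_iff.mpr fun g => comm_of_card_center_ge hG (Or.inl hbig) g (u * u)
  · exact mem_center_iff.mpr fun g => comm_of_card_center_ge hG (Or.inr hbig) g (u * u)

/-- Pointwise form: `g u² = u² g`. [folklore] -/
theorem mul_self_comm (u g : G) : g * (u * u) = u * u * g := mem_center_iff.mp (mul_self_mem_center hG h8 u) g

/-- **Every commutator is central**: `⁅x, y⁆ = (xy)² x² y² · (correction)` — precisely `⁅x,y⁆ = (x y)² · (y⁻¹ x⁻¹ y⁻¹ x⁻¹ ...)`; we use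
`⁅x, y⁆ = (xy)(xy) · (y³ x³ ...)`: with `x⁻¹ = x³ = x·x²` and `y⁻¹ = y·y²` one gets `⁅x,y⁆ = (xy)(xy)·x²·y²`, a product of central squares. [folklore] -/
theorem commutatorElement_mem_center (x y : G) : ⁅x, y⁆ ∈ center G := by
  have h4 : ∀ g : G, g ^ 4 = 1 := QuaternionDoubling.pow_four_eq_one_of_no_eight hG h8
  have hxinv : x⁻¹ = x * (x * x) := by
    rw [eq_comm, ← mul_inv_eq_one, inv_inv, show x * (x * x) * x = x ^ 4 by simp only [pow_succ, pow_zero, one_mul, mul_assoc], h4]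
  have hyinv : y⁻¹ = y * (y * y) := by
    rw [eq_comm, ← mul_inv_eq_one, inv_inv, show y * (y * y) * y = y ^ 4 by simp only [pow_succ, pow_zero, one_mul, mul_assoc], h4]
  have key : ⁅x, y⁆ = (x * y) * (x * y) * ((x * x) * (y * y)) := by
    rw [commutatorElement_def, hxinv, hyinv]
    calc x * y * (x * (x * x)) * (y * (y * y)) = x * y * x * ((x * x) * y) * (y * y) := by simp only [mul_assoc]
      _ = x * y * x * (y * (x * x)) * (y * y) := by rw [mul_self_comm hG h8 x y]
      _ = (x * y) * (x * y) * ((x * x) * (y * y)) := by simp only [mul_assoc]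
  rw [key]
  exact (center G).mul_mem (mul_self_mem_center hG h8 _) ((center G).mul_mem (mul_self_mem_center hG h8 _) (mul_self_mem_center hG h8 _))

/-- Pointwise form: `g ⁅x,y⁆ = ⁅x,y⁆ g`. [folklore] -/
theorem commutatorElement_comm (x y g : G) : g * ⁅x, y⁆ = ⁅x, y⁆ * g := mem_center_iff.mp (commutatorElement_mem_center hG h8 x y) g

/-- `⁅x, y⁆² = 1`: `⁅x,y⁆² = ⁅x, y²⁆ = 1`. [folklore] -/
theorem commutatorElement_mul_self (x y : G) : ⁅x, y⁆ * ⁅x, y⁆ = 1 := by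
  rw [← commutatorElement_mul_right (commutatorElement_comm hG h8 x y),
    commutatorElement_eq_one_of_central_right (fun g => mul_self_comm hG h8 y g)]

/-- `⁅y, x⁆ = ⁅x, y⁆` (commutators are involutions). [folklore] -/
theorem commutatorElement_symm (x y : G) : ⁅y, x⁆ = ⁅x, y⁆ := by
  rw [← commutatorElement_inv, inv_eq_of_mul_eq_one_right (commutatorElement_mul_self hG h8 x y)]

/-! ## §3 The centre has order `4` -/

/-- **The centraliser of a non-central element has index two** when `|Z(G)| = 2` (the commutator with `a` takes the two values of `Z(G)`):
for `b ∉ C(a)`, `g ↦ g b` swaps `C(a)` and its complement. [folklore] -/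
theorem index_centralizer_eq_two {a b : G} (hab : a * b ≠ b * a) (h2 : Nat.card (center G) = 2) :
    (centralizer ({a} : Set G)).index = 2 := by
  rw [index_eq_two_iff]
  refine ⟨b, fun g => ?_⟩
  have hz1 : ⁅b, a⁆ ≠ 1 := fun h => hab (commutatorElement_eq_one_iff_mul_comm.mp h).symm
  have hbC : b ∉ centralizer ({a} : Set G) := fun h => hab (mem_centralizer_singleton.mp h)
  by_cases hg : g ∈ centralizer ({a} : Set G)
  · -- `g ∈ C(a)`: then `g b ∉ C(a)`
    have hgb : g * b ∉ centralizer ({a} : Set G) := fun h =>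
      hbC (by simpa using (centralizer ({a} : Set G)).mul_mem ((centralizer ({a} : Set G)).inv_mem hg) h)
    exact Or.inr ⟨hg, hgb⟩
  · -- `g ∉ C(a)`: `⁅g, a⁆ = ⁅b, a⁆`, so `⁅g b, a⁆ = ⁅b,a⁆² = 1`
    have hg1 : ⁅g, a⁆ ≠ 1 := fun h => hg (mem_centralizer_singleton.mpr (commutatorElement_eq_one_iff_mul_comm.mp h).symm)
    have hga : ⁅g, a⁆ = ⁅b, a⁆ := by
      rcases eq_one_or_eq_of_card_two (center G) h2 (commutatorElement_mem_center hG h8 b a) hz1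
        (commutatorElement_mem_center hG h8 g a) with h | h
      · exact absurd h hg1
      · exact h
    have hgb : g * b ∈ centralizer ({a} : Set G) := by
      rw [mem_centralizer_singleton, eq_comm, ← commutatorElement_eq_one_iff_mul_comm,
        commutatorElement_mul_left (commutatorElement_comm hG h8 b a), hga, commutatorElement_mul_self hG h8]
    exact Or.inl ⟨hgb, hg⟩

/-- **THE CENTRE DOES NOT HAVE ORDER `2`** (for a group of order `16` without an element of order `8`). [folklore] -/
theorem card_center_ne_two : Nat.card (center G) ≠ 2 := by
  classical
  intro h2
  -- `G` is not abelian (else `Z = G`)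
  obtain ⟨a, b, hab⟩ : ∃ a b : G, a * b ≠ b * a := by
    by_contra hall
    push Not at hall
    have htop : center G = ⊤ := by
      rw [eq_top_iff]; exact fun x _ => mem_center_iff.mpr fun g => hall g x
    rw [htop, card_top, hG] at h2
    exact absurd h2 (by norm_num)
  have hba : b * a ≠ a * b := fun h => hab h.symm
  -- `K = C(a) ∩ C(b)` has order `4`
  let K := centralizer ({a} : Set G) ⊓ centralizer ({b} : Set G)
  have hKidx : K.index ≤ 4 := by
    have h := index_inf_le (H := centralizer ({a} : Set G)) (K := centralizer ({b} : Set G))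
    rw [index_centralizer_eq_two hG h8 hab h2, index_centralizer_eq_two hG h8 hba h2] at h
    exact h
  have hKcard4 : 4 ≤ Nat.card K := by
    have h := K.card_mul_index
    rw [hG] at h
    have hi : K.index ∣ 16 := ⟨Nat.card K, by rw [mul_comm]; exact h.symm⟩
    have hipos : 0 < K.index := Nat.pos_of_ne_zero fun h0 => by rw [h0, mul_zero] at h; exact absurd h (by norm_num)
    interval_cases hki : K.index <;> omega
  have haK : a ∉ K := fun h => hab (mem_centralizer_singleton.mp (mem_inf.mp h).2).symm
  have hKle8 : Nat.card K ≤ 4 := by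
    -- `K < C(a)` and `|C(a)| = 8`
    have hCa : Nat.card (centralizer ({a} : Set G)) = 8 := by
      have h := (centralizer ({a} : Set G)).card_mul_index
      rw [index_centralizer_eq_two hG h8 hab h2, hG] at h; omega
    have hle : K ≤ centralizer ({a} : Set G) := inf_le_left
    have hdvd : Nat.card K ∣ 8 := hCa ▸ card_dvd_of_le hle
    have hne : Nat.card K ≠ 8 := fun h =>
      haK ((eq_of_le_of_card_ge hle (by rw [hCa, h])) ▸ mem_centralizer_singleton.mpr rfl : a ∈ K)
    have hle8 : Nat.card K ≤ 8 := Nat.le_of_dvd (by norm_num) hdvd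
    interval_cases hk : Nat.card K <;> omega
  have hK4 : Nat.card K = 4 := le_antisymm hKle8 hKcard4
  -- `K` is abelian
  haveI : Fact (Nat.Prime 2) := ⟨Nat.prime_two⟩
  have hKcomm : ∀ x y : K, x * y = y * x :=
    (IsPGroup.isMulCommutative_of_card_eq_prime_sq (p := 2) (G := K) (by rw [hK4]; norm_num)).is_comm.comm
  -- an element `d ∈ K ∖ Z`
  obtain ⟨d, hdK, hdZ⟩ : ∃ d : G, d ∈ K ∧ d ∉ center G := by
    by_contra hall
    push Not at hall
    have hle : K ≤ center G := fun x hx => hall x hx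
    have := card_le_of_le hle
    rw [hK4, h2] at this
    omega
  -- a partner `e` of `d` with `⁅d, e⁆ ≠ 1`, adjusted into `K`
  obtain ⟨e, hde⟩ : ∃ e : G, ⁅d, e⁆ ≠ 1 := by
    by_contra hall
    push Not at hall
    exact hdZ (mem_center_iff.mpr fun g => ((commutatorElement_eq_one_iff_mul_comm.mp (hall g))).symm)
  have hda : ⁅d, a⁆ = 1 := commutatorElement_eq_one_iff_mul_comm.mpr (mem_centralizer_singleton.mp (mem_inf.mp hdK).1).symm
  have hdb : ⁅d, b⁆ = 1 := commutatorElement_eq_one_iff_mul_comm.mpr (mem_centralizer_singleton.mp (mem_inf.mp hdK).2).symm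
  have hcc := commutatorElement_comm hG h8
  have htwo : ∀ {x y s t : G}, ⁅x, y⁆ ≠ 1 → ⁅s, t⁆ ≠ 1 → ⁅s, t⁆ = ⁅x, y⁆ := fun {x y s t} hxy hst => by
    rcases eq_one_or_eq_of_card_two (center G) h2 (commutatorElement_mem_center hG h8 x y) hxy
      (commutatorElement_mem_center hG h8 s t) with h | h
    · exact absurd h hst
    · exact h
  -- step 1: kill `⁅a, e⁆` by multiplying with `b`
  obtain ⟨e₁, hde₁, hae₁⟩ : ∃ e₁ : G, ⁅d, e₁⁆ ≠ 1 ∧ ⁅a, e₁⁆ = 1 := by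
    by_cases hae : ⁅a, e⁆ = 1
    · exact ⟨e, hde, hae⟩
    · refine ⟨e * b, ?_, ?_⟩
      · rw [commutatorElement_mul_right (hcc d b), hdb, mul_one]; exact hde
      · have hab1 : ⁅a, b⁆ ≠ 1 := fun h => hab (commutatorElement_eq_one_iff_mul_comm.mp h)
        rw [commutatorElement_mul_right (hcc a b), htwo hab1 hae, commutatorElement_mul_self hG h8]
  -- step 2: kill `⁅b, e₁⁆` by multiplying with `a`
  obtain ⟨e₂, hde₂, hae₂, hbe₂⟩ : ∃ e₂ : G, ⁅d, e₂⁆ ≠ 1 ∧ ⁅a, e₂⁆ = 1 ∧ ⁅b, e₂⁆ = 1 := by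
    by_cases hbe : ⁅b, e₁⁆ = 1
    · exact ⟨e₁, hde₁, hae₁, hbe⟩
    · refine ⟨e₁ * a, ?_, ?_, ?_⟩
      · rw [commutatorElement_mul_right (hcc d a), hda, mul_one]; exact hde₁
      · rw [commutatorElement_mul_right (hcc a a), hae₁, one_mul]
        exact commutatorElement_eq_one_iff_mul_comm.mpr rfl
      · have hba1 : ⁅b, a⁆ ≠ 1 := fun h => hba (commutatorElement_eq_one_iff_mul_comm.mp h)
        rw [commutatorElement_mul_right (hcc b a), htwo hba1 hbe, commutatorElement_mul_self hG h8]
  -- `e₂ ∈ K`, and `K` is abelian: contradiction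
  have he₂K : e₂ ∈ K := mem_inf.mpr
    ⟨mem_centralizer_singleton.mpr (commutatorElement_eq_one_iff_mul_comm.mp hae₂),
     mem_centralizer_singleton.mpr (commutatorElement_eq_one_iff_mul_comm.mp hbe₂)⟩
  apply hde₂
  rw [commutatorElement_eq_one_iff_mul_comm]
  have h := hKcomm ⟨d, hdK⟩ ⟨e₂, he₂K⟩
  exact congrArg Subtype.val h

/-- **THE CENTRE OF A NON-ABELIAN GROUP OF ORDER `16` WITHOUT AN ELEMENT OF ORDER `8` HAS ORDER `4`.** [folklore] -/
theorem card_center_eq_four {a b : G} (hab : a * b ≠ b * a) : Nat.card (center G) = 4 := by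
  rcases card_center_mem hG with h | h | h | h
  · exact absurd h (card_center_ne_two hG h8)
  · exact h
  · exact absurd (comm_of_card_center_ge hG (Or.inl h) a b) hab
  · exact absurd (comm_of_card_center_ge hG (Or.inr h) a b) hab

end Structure

end Summit.HodgeConjecture.CorCM.Census.OrderSixteen
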